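import Literature.MathematicalPhysics.QuantumFieldTheory.Balaban1983to89.B2Eq243RegionsTower
import Literature.MathematicalPhysics.QuantumFieldTheory.Balaban1983to89.B2Eq255Concrete
import Literature.MathematicalPhysics.QuantumFieldTheory.Balaban1983to89.B1TorusRegionHSizes
import Literature.MathematicalPhysics.QuantumFieldTheory.Balaban1983to89.B1Ineq234Concrete

/-!
# `Balaban1983to89.B2Eq28RegionsBigBlockUnion` — [Balaban1982Higgs2] (2.7)–(2.8) p. 558 / (2.43) p. 566 regions ARE «sums of
# big blocks» in the sense of [Balaban1982Higgs1] Prop. 2.1 p. 610 on the carrier of record: the dictionary between the typer's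
# large-block regions (`HiggsRescaling.IsUnionOfLargeBlocks`, `B2Eq243RegionsTower.towerRegion`) and p35's cube-lattice
# hypothesis `B1TorusRegionHSizes.IsBigBlockUnion K K₀` of the (I.2.24)–(I.2.26)-for-regions theorems — with `K₀ = M`

statement-level skeleton of published theorems with citation tags; proofs where landed; nothing here is a claim
about the Yang–Mills mass gap

PDF held: `paper:balaban1982-cmp86-higgs23-ii` p. 558 [PDF 4] ((2.7)–(2.8)), p. 570 [PDF 16] ((2.56)); `paper:balaban1982-cmp85-higgs23-i`
p. 606–607 [PDF 4–5] ((1.17)–(1.20): blocks, large blocks), p. 610 [PDF 8] (Prop. 2.1: «let Ω^{(k)} ⊂ T^{(k)}_1 be a sum of big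
blocks with M sufficiently large»).

CITATION HEADER (lean-in-tree rule).  T. Bałaban, *(Higgs)₂,₃ quantum fields in a finite volume. II. An upper bound*, Commun.
Math. Phys. **86** (1982) 555–594 [Balaban1982Higgs2]; *… I. A lower bound*, Commun. Math. Phys. **85** (1982) 603–626
[Balaban1982Higgs1].  Cell `lit-balaban` (HOME `run/shared/lean/pub/lit-balaban/`), Phase-2 proof seat **p23** gen 17 (unit
`lit-balaban-p23-g17`; v1 = p332981 ACCEPTED 6c62a3100131; v1.1 DOC-ONLY: the (2.56) page locator below, referee ref-1 citeloc nit;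
v1.2 (gen 20) DOC-ONLY: «(1.16)–(1.20) p.607» → «pp.606–607» and the (1.17) quote located on p.607, summit-lit1 CITELOC P79-001 / QF79-002);
SKELETON rows **B2.Eq2.7** ((2.7)–(2.8); owner r02) and **B2.Prop2.2** / **B2.Lem2.4** (the region
hypotheses of own `B2Ineq258HiggsRegion` / `B2Eq267HiggsRegion`), cells only — a DICTIONARY file, no new notion.  USED BY NAME:
the typer's `HiggsRescaling.IsUnionOfLargeBlocks` / `largeBlockOf` (large blocks of `T^{(j)}`: labels `⌊x_μ/(LM)⌋`, p. 607),
`B2Eq28RegionsConcrete.largeBlockOf_val` / `isUnionOfLargeBlocks_iff` / `isUnionOfLargeBlocks_blockOf_congr`,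
`B2Eq243RegionsTower.towerRegion` / `towerRegion_isUnionOfLargeBlocks` (the (2.7)–(2.8)/(2.43) tower of every step),
`B2Eq324NestedRegions.prime` (`Λ′`), `B2Eq255Concrete.underRegion` (`Bᵏ(Λ₂) ⊂ T_ε`, the region of (2.56)), p35's
`B1TorusRegionHSizes.IsBigBlockUnion K K₀` (membership depends only on `⌊x_μ/(LᴷK₀)⌋`, cells of `LᴷK₀` fine sites) and
`B1TorusCubeCover.half`, r14's `B1Ineq234Concrete.val_blockIter_all` (`(x_k)_μ = ⌊x_μ/Lᵏ⌋`).

WHAT IS PRINTED.  I p. 607 [PDF 5]: the large blocks are *"defined in the same way, only L is replaced by ML"*; I p. 610 [PDF 8],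
Prop. 2.1: *"Let a set Ω satisfies Ω = Bᵏ(Ω^{(k)}) and let Ω^{(k)} ⊂ T^{(k)}_1 be a sum of big blocks with M sufficiently large."*;
II p. 558 [PDF 4]: *"Λ₀^c is the sum of all large blocks of T₁ distant from … (2.7) … Λ_{i+1}^c is the sum of all large blocks of T₁
with distances from the set Λ_i^c less or equal r(ε). (2.8)"*; II p. 570 [PDF 16], Prop. 2.2: *"Let Ω and A satisfy the
assumptions of Proposition I.2.1"*, applied (p. 570, (2.56)) to `Ω = Bᵏ(Λ₂^{(k−1)′})`.

WHAT THIS FILE PROVES (kernel-checked, zero `sorry`; theorems only, no definition, no `Prop` fact).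
 §1 `isBigBlockUnion_of_dvd` — coarser cells are unions of finer ones: `IsBigBlockUnion K K₁ Ω → IsBigBlockUnion K K₀ Ω` for `K₀ ∣ K₁`.
 §2 **`isBigBlockUnion_underRegion`** — for a union `Λ` of large blocks of `T^{(k)}` (the typer's reading: cells of `L·M` sites of
    `T^{(k)}`), `Bᵏ(Λ) ⊂ T_ε` is a big-block union at level `k` with cube size `K₀ = L·M`, hence (`isBigBlockUnion_underRegion_M`)
    with `K₀ = M`;
 §3 **`isBigBlockUnion_underRegion_prime`** — for a union `Λ` of large blocks of `T^{(j)}`, the region `B^{j+1}(Λ′) ⊂ T_ε` of (2.56)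
    (`underRegion (j+1) (prime Λ)`) is a big-block union at level `k = j + 1` with cube size EXACTLY `K₀ = M` (a large block of
    `T^{(j)}` has `L·M·Lʲ = M·Lᵏ` fine sites a side), via `blockIter_succ_mem_prime_iff_of_largeBlocks` (`x_k ∈ Λ′ ↔ x_j ∈ Λ`);
 §4 the tower instances: **`isBigBlockUnion_towerRegion_prime`** — `Bᵏ(Λ_i^{(k−1)′})` is `IsBigBlockUnion k M` for every step and
    every `i` (in particular print's `Ω = Bᵏ(Λ₂^{(k−1)′})` of (2.56)/(2.58) and `Bᵏ(Λ₆^{(k−1)′})`, `Bᵏ(Λ₇^{(k−1)′})` of Lemma 2.4),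
    and `isBigBlockUnion_towerRegion` (`Bʲ(Λ_i^{(j)})` at level `j+1`… stated at level `j` with `K₀ = L·M` and `K₀ = M`).
CONSEQUENCE (why it matters).  The (2.58)-for-regions theorems of `B2Ineq258HiggsRegion` (v1–v1.2) and (2.67) of
`B2Eq267HiggsRegion` take p35's `IsBigBlockUnion k K₀ Ω` as the shape of «Ω a sum of big blocks»; this file shows print's own
regions meet it with `K₀ = M` (so p35's side conditions read `M ∣ M`, `M ≥ K₀min` = «M sufficiently large», `3LᵏM ≤ |T_ε|_μ`).
HONEST SCOPE.  Pure lattice bookkeeping; the typer's large blocks of `T^{(j)}` have `L·M` sites of `T^{(j)}` a side (its reading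
of I (1.17) p. 606–607, `largeBlockOf = ⌊·/(LM)⌋`), which is what makes `K₀ = M` exact at the next level; nothing analytic.
-/

namespace Literature.MathematicalPhysics.QuantumFieldTheory.Balaban1983to89.B2Eq28RegionsBigBlockUnion

open Literature.MathematicalPhysics.QuantumFieldTheory.Balaban1983to89.HiggsLattice (blockOf)
open Literature.MathematicalPhysics.QuantumFieldTheory.Balaban1983to89.HiggsAveraging (blockIter)
open Literature.MathematicalPhysics.QuantumFieldTheory.Balaban1983to89.HiggsRescaling (IsUnionOfLargeBlocks largeBlockOf)
open Literature.MathematicalPhysics.QuantumFieldTheory.Balaban1983to89.B2Eq28RegionsConcrete (largeBlockOf_val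
  isUnionOfLargeBlocks_iff isUnionOfLargeBlocks_blockOf_congr)
open Literature.MathematicalPhysics.QuantumFieldTheory.Balaban1983to89.B2Eq243RegionsTower (towerRegion
  towerRegion_isUnionOfLargeBlocks)
open Literature.MathematicalPhysics.QuantumFieldTheory.Balaban1983to89.B2Eq324NestedRegions (prime mem_prime)
open Literature.MathematicalPhysics.QuantumFieldTheory.Balaban1983to89.B2Eq255Concrete (underRegion mem_underRegion)
open Literature.MathematicalPhysics.QuantumFieldTheory.Balaban1983to89.B1TorusRegionHSizes (IsBigBlockUnion)
open Literature.MathematicalPhysics.QuantumFieldTheory.Balaban1983to89.B1TorusCubeCover (half)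
open Literature.MathematicalPhysics.QuantumFieldTheory.Balaban1983to89.B1Ineq234Concrete (val_blockIter_all)

variable {P : HiggsLattice.Params}

/-! ## §1. Coarser cells are unions of finer cells -/

/-- If membership in `Ω` depends only on the cells of side `LᴷK₁` and `K₀ ∣ K₁`, it depends only on the cells of side `LᴷK₀`
(each coarse cell is a union of fine ones). [cite: Balaban1982Higgs1, (1.17) p.606; p.607 «only L is replaced by ML», dictionary] -/
theorem isBigBlockUnion_of_dvd {K K₀ K₁ : ℕ} (hd : K₀ ∣ K₁) {Ω : Finset (HiggsLattice.Site P 0)}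
    (h : IsBigBlockUnion K K₁ Ω) : IsBigBlockUnion K K₀ Ω := by
  intro x x' hxx'
  refine h x x' fun μ => ?_
  obtain ⟨c, hc⟩ := hd
  have hμ := hxx' μ
  unfold half at hμ ⊢
  rw [hc, ← mul_assoc, ← Nat.div_div_eq_div_mul (x μ).val (P.L ^ K * K₀) c,
    ← Nat.div_div_eq_div_mul (x' μ).val (P.L ^ K * K₀) c, hμ]

/-! ## §2. `Bᵏ(Λ)` for a union `Λ` of large blocks of `T^{(k)}` -/

/-- For a union `Λ` of large blocks of `T^{(k)}` (cells of `L·M` sites of `T^{(k)}`, i.e. `Lᵏ·(LM)` fine sites), the fine region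
`Bᵏ(Λ) = {x : x_k ∈ Λ}` is a big-block union at level `k` with cube size `L·M`.
[cite: Balaban1982Higgs1, Prop. 2.1 p.610 «Ω = Bᵏ(Ω^{(k)}) … Ω^{(k)} ⊂ T^{(k)}_1 be a sum of big blocks»] -/
theorem isBigBlockUnion_underRegion {k : ℕ} {Λ : Finset (HiggsLattice.Site P k)} (hΛ : IsUnionOfLargeBlocks Λ) :
    IsBigBlockUnion k (P.L * P.M) (underRegion k Λ) := by
  intro x x' hxx'
  rw [mem_underRegion, mem_underRegion]
  refine (isUnionOfLargeBlocks_iff Λ).mp hΛ _ _ ?_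
  funext μ
  apply ZMod.val_injective
  have hμ := hxx' μ
  unfold half at hμ
  rw [largeBlockOf_val, largeBlockOf_val, val_blockIter_all, val_blockIter_all, Nat.div_div_eq_div_mul,
    Nat.div_div_eq_div_mul, hμ]

/-- The same with cube size `M` (the `L·M`-cells are unions of `M`-cells). [cite: Balaban1982Higgs1, Prop. 2.1 p.610] -/
theorem isBigBlockUnion_underRegion_M {k : ℕ} {Λ : Finset (HiggsLattice.Site P k)} (hΛ : IsUnionOfLargeBlocks Λ) :
    IsBigBlockUnion k P.M (underRegion k Λ) :=
  isBigBlockUnion_of_dvd (Dvd.intro_left P.L rfl) (isBigBlockUnion_underRegion hΛ)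

/-! ## §3. `B^{j+1}(Λ′)` for a union `Λ` of large blocks of `T^{(j)}`: cube size exactly `M` -/

/-- `x_{j+1} ∈ Λ′ ↔ x_j ∈ Λ` for a union `Λ` of large blocks of `T^{(j)}` ((I.1.16): `Λ′ = Λ ∩ T^{(j+1)}`; own g16
`B2Eq298RegularOmega.blockIter_succ_mem_prime_iff` is the tower case). [cite: Balaban1982Higgs1, (1.16)–(1.20) pp.606–607] -/
theorem blockIter_succ_mem_prime_iff_of_largeBlocks {j : ℕ} {Λ : Finset (HiggsLattice.Site P j)} (hΛ : IsUnionOfLargeBlocks Λ)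
    (z : HiggsLattice.Site P 0) : blockIter (j + 1) z ∈ prime Λ ↔ blockIter j z ∈ Λ := by
  rw [mem_prime]
  constructor
  · intro h
    exact h (blockIter j z) rfl
  · intro h x hx
    exact (isUnionOfLargeBlocks_blockOf_congr hΛ (x := x) (x' := blockIter j z) hx).mpr h

/-- **For a union `Λ` of large blocks of `T^{(j)}`, the region `B^{j+1}(Λ′) ⊂ T_ε` of (2.56) is a big-block union at level
`k = j + 1` with cube size `K₀ = M`** (a large block of `T^{(j)}` is `L·M·Lʲ = M·Lᵏ` fine sites a side).
[cite: Balaban1982Higgs2, (2.56) p.570 «G_k(Bᵏ(Λ₂^{(k−1)′}), A^{(k)})», Prop. 2.2 p.570 «Let Ω and A satisfy the assumptions of Proposition I.2.1»]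
[cite: Balaban1982Higgs1, Prop. 2.1 p.610] -/
theorem isBigBlockUnion_underRegion_prime {j : ℕ} {Λ : Finset (HiggsLattice.Site P j)} (hΛ : IsUnionOfLargeBlocks Λ) :
    IsBigBlockUnion (j + 1) P.M (underRegion (j + 1) (prime Λ)) := by
  intro x x' hxx'
  rw [mem_underRegion, mem_underRegion, blockIter_succ_mem_prime_iff_of_largeBlocks hΛ,
    blockIter_succ_mem_prime_iff_of_largeBlocks hΛ]
  refine (isUnionOfLargeBlocks_iff Λ).mp hΛ _ _ ?_
  funext μ
  apply ZMod.val_injective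
  have hμ := hxx' μ
  unfold half at hμ
  rw [pow_succ] at hμ
  rw [largeBlockOf_val, largeBlockOf_val, val_blockIter_all, val_blockIter_all, Nat.div_div_eq_div_mul,
    Nat.div_div_eq_div_mul]
  have h1 : P.L ^ j * (P.L * P.M) = P.L ^ j * P.L * P.M := by ring
  rw [h1, hμ]

/-! ## §4. The (2.7)–(2.8)/(2.43) tower -/

/-- **Print's regions `Bᵏ(Λ_i^{(k−1)′})` — `Ω = Bᵏ(Λ₂^{(k−1)′})` of (2.56)/(2.58), `Bᵏ(Λ₆^{(k−1)′})`, `Bᵏ(Λ₇^{(k−1)′})` of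
Lemma 2.4 — are big-block unions at level `k` with cube size `M`**, for the typer's tower of every step and every index `i`.
[cite: Balaban1982Higgs2, (2.7)–(2.8) p.558, (2.43) p.566, (2.56) p.570] [cite: Balaban1982Higgs1, Prop. 2.1 p.610] -/
theorem isBigBlockUnion_towerRegion_prime (bad : (j : ℕ) → Set (HiggsLattice.Site P j)) (r : ℕ → ℝ) (j i : ℕ) :
    IsBigBlockUnion (j + 1) P.M (underRegion (j + 1) (prime (towerRegion bad r j i))) :=
  isBigBlockUnion_underRegion_prime (towerRegion_isUnionOfLargeBlocks (bad := bad) (r := r) j i)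

/-- `Bʲ(Λ_i^{(j)}) ⊂ T_ε` is a big-block union at level `j` with cube size `L·M`, and with cube size `M`.
[cite: Balaban1982Higgs2, (2.7)–(2.8) p.558, (2.43) p.566] [cite: Balaban1982Higgs1, Prop. 2.1 p.610] -/
theorem isBigBlockUnion_towerRegion (bad : (j : ℕ) → Set (HiggsLattice.Site P j)) (r : ℕ → ℝ) (j i : ℕ) :
    IsBigBlockUnion j (P.L * P.M) (underRegion j (towerRegion bad r j i))
      ∧ IsBigBlockUnion j P.M (underRegion j (towerRegion bad r j i)) :=
  ⟨isBigBlockUnion_underRegion (towerRegion_isUnionOfLargeBlocks (bad := bad) (r := r) j i),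
    isBigBlockUnion_underRegion_M (towerRegion_isUnionOfLargeBlocks (bad := bad) (r := r) j i)⟩

end Literature.MathematicalPhysics.QuantumFieldTheory.Balaban1983to89.B2Eq28RegionsBigBlockUnion
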